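/-
Adjudication Team R (D-0069 campaign, cell siegel-zhang): kernel range/region certificates for the
two §7 gap rows G-adj2-1 ((7.13) printed range vs the (7.2) support) and G-adj2-3 ((7.19) printed
contour vs the classical zero-free region). INSUFFICIENCY-AS-PRINTED certificates: no statement of
the manuscript is refuted here, and nothing here is a claim about Siegel zeros or Theorems 1–2.
-/
import Literature.NumberTheory.LFunctions.Zhang2022.SkeletonReductions
import Literature.NumberTheory.LFunctions.Zhang2022.Section7cStatements

/-! # Team R: §7 range arithmetic of the gap rows G-adj2-1 and G-adj2-3

Y. Zhang, *Discrete mean estimates and the Landau–Siegel zero*, arXiv:2211.02515v1 (2022)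
[Zhang2022LandauSiegel] — an unrefereed manuscript under adjudication. **WHAT THIS IS NOT**: any
claim about Theorems 1–2 of the manuscript or about Landau–Siegel zeros; no lemma of the
manuscript is refuted below. These are the χ-free arithmetic cores (R-pattern, plan/ADJ-TEAMS.md
§ R) of two GAP-LEDGER rows, certified over the real typed objects.

**G-adj2-1** (`Z22:(7.13)`, `Z22:Prop7.1.pf.b-error`; [Z22 p.38, (7.13), tex L2006–2010]): the
(7.13) triple sum `Σ′_{d,h,r}` is printed over `dhr < P₁` and `r > 1`
(`Section7cStatements.tripleSet`, typed AS PRINTED with this AMBIGUITY flagged), while the class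
(7.2) supports sequences up to `n < PT⁻²` (`Skeleton.Adm72`/`Skeleton.Nsupp`, tex L1815) and
(7.15) is then proved only for `D ≤ R < (dh)⁻¹P₁` [tex L2025]. The tree already certifies the
scale gap `P₁ < PT⁻²` (`Skeleton.P1_lt_P_div_T_sq`, CITED, not restated). New here:
`2·P₁ ≤ PT⁻²` and the concrete dropped triple — for `𝓛 ≥ 2` there is an integer `r` with
`P₁ < r < PT⁻²`, so the triple `(1,1,r)` is excluded from the printed range `tripleSet` although
`r` is below the (7.2) support bound. This certifies the statement/proof mismatch of the row
(the printed restriction drops a nonempty part of the admissible range); whether the dropped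
terms contribute is the gap row's in-cone question (repair dispositions there), NOT certified
here. [cite: Zhang2022LandauSiegel, §7 (7.2) p.33 tex L1815, (7.13) p.38 tex L2006–2010,
(7.15) p.38 tex L2025]

**G-adj2-3** (`Z22:(7.19)`, `Z22:§7.u047`–`§7.u049`, `Z22:Prop7.1.pf.c-main`; [Z22 p.40, displays
after (7.19), tex L2104–2127]): the (7.19) contour is moved to the vertical segment
`σ = 1 − 𝓛⁻¹`, `|t| ≤ D` (`Section7dStatements.vert747`/`contour719`), and the integrand carries
`ζ(s+β₁)ζ(s+β₂)ζ(s+β₃)/ζ(s)`; the justification offered is "Lemma 5.2 (i) and standard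
estimates". A classical zero-free region of constant `c`, `ζ(σ+it) ≠ 0` for
`σ > 1 − c/log |t|`, covers the point `(1 − 𝓛⁻¹) + it` of that segment only for `|t| < D^c`:
below, for EVERY constant `0 < c < 1` — so in particular for the explicit certified constant
`c = 1/5.573412` of `Literature.NumberTheory.LFunctions.zero_free_region_mossinghoff_trudgian_2015_of_mossinghoff_trudgian_yang`
(MTY 2024 / MT 2015; every known classical constant has `c < 1`) — the sub-segment of heights
`exp(c𝓛) = D^c ≤ t ≤ D` is nonempty and lies OUTSIDE the region `σ > 1 − c/log t`. So no
classical zero-free region input covers the printed contour as printed; the repair of the gap row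
(G-adj2-3 disposition: contour at `σ = 1 − (c/2)𝓛⁻¹`) stays in the region. Nothing here asserts
that `ζ` HAS zeros near the printed segment — only that the cited class of inputs does not
justify it. [cite: Zhang2022LandauSiegel, §7 p.40, tex L2104–2127;
MossinghoffTrudgianYangRNT2024, Theorem 1.3]

Consumers: plan/GAP-LEDGER.md rows G-adj2-1 / G-adj2-3 (kernel backing of the "why not
derivable" clauses; gaps stay OPEN — the discharge-lane repairs are unaffected);
plan/ADJ-TEAMS.md § R claims table.
-/

noncomputable section

open Real

namespace Literature.NumberTheory.LFunctions.Zhang2022.AdjTeamR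

/-! ## G-adj2-1: the (7.13) printed range `dhr < P₁` vs the (7.2) support `n < PT⁻²` -/

/-- For `𝓛 ≥ 2`: `2·P₁ ≤ PT⁻²` (`log 2 + 0.504·𝓛⁹ ≤ 𝓛⁹ − 2𝓛^{1.1}`) — the scale gap of
G-adj2-1 with room for an integer point; strengthens (and cites the proof pattern of) the tree's
`Skeleton.P1_lt_P_div_T_sq`. [cite: Zhang2022LandauSiegel, §2 (2.21), §7 (7.2)] -/
theorem seven13_two_P1_le_support_bound (D : ℕ) (hD : 2 ≤ Real.log D) :
    2 * Skeleton.P1 D ≤ Skeleton.bigP D / Skeleton.bigT D ^ 2 := by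
  have hℓ : 2 ≤ Skeleton.ell D := by rw [Skeleton.ell]; exact hD
  rw [Skeleton.P1, Skeleton.bigP, Skeleton.bigT, ← Real.exp_mul, ← Real.exp_nat_mul,
    ← Real.exp_sub, show (2 : ℝ) = Real.exp (Real.log 2) from (Real.exp_log two_pos).symm,
    ← Real.exp_add, Real.exp_le_exp]
  have h11 : Skeleton.ell D ^ (1.1 : ℝ) ≤ Skeleton.ell D ^ (2 : ℝ) :=
    Real.rpow_le_rpow_of_exponent_le (by linarith) (by norm_num)
  rw [Real.rpow_two] at h11
  have hlog2 : Real.log 2 < 0.6931471808 := Real.log_two_lt_d9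
  push_cast
  nlinarith [pow_le_pow_left₀ (by linarith : (0 : ℝ) ≤ 2) hℓ 7,
    pow_pos (by linarith : (0 : ℝ) < Skeleton.ell D) 2,
    mul_le_mul_of_nonneg_left (pow_le_pow_left₀ (by linarith : (0 : ℝ) ≤ 2) hℓ 7)
      (pow_nonneg (by linarith : (0 : ℝ) ≤ Skeleton.ell D) 2),
    show Skeleton.ell D ^ 9 = Skeleton.ell D ^ 2 * Skeleton.ell D ^ 7 by ring]

/-- `P₁ > 1` for `𝓛 ≥ 2` (indeed for `𝓛 > 0`). [cite: Zhang2022LandauSiegel, §2 (2.21)] -/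
theorem one_lt_P1 (D : ℕ) (hD : 2 ≤ Real.log D) : 1 < Skeleton.P1 D := by
  have hℓ : 2 ≤ Skeleton.ell D := by rw [Skeleton.ell]; exact hD
  rw [Skeleton.P1, Skeleton.bigP, ← Real.exp_mul,
    show (1 : ℝ) = Real.exp 0 from Real.exp_zero.symm, Real.exp_lt_exp]
  nlinarith [pow_pos (by linarith : (0 : ℝ) < Skeleton.ell D) 9]

/-- **THE DROPPED TRIPLE of G-adj2-1** (`Z22:(7.13)`, [Z22 p.38, tex L2006–2010]): for `𝓛 ≥ 2`
there is an integer `r` with `1 < r`, `P₁ < r < PT⁻²`: the triple `(1,1,r)` is NOT in the printed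
(7.13) index set `Σ′_{d,h,r}` (`Section7cStatements.tripleSet`, "`dhr < P₁` and `r > 1`"),
although `r` lies strictly below the (7.2) support bound `PT⁻²` (`Skeleton.Adm72`: `a(n) = 0`
only for `n ≥ PT⁻²`). Insufficiency of the printed range as printed (statement/proof mismatch of
the gap row); refutes no lemma; whether such triples contribute to (7.12) is the gap row's
in-cone repair question. [cite: Zhang2022LandauSiegel, §7 (7.2) tex L1815, (7.13) tex
L2006–2010] -/
theorem seven13_dropped_triple (D : ℕ) (hD : 2 ≤ Real.log D) :
    ∃ r : ℕ, 1 < r ∧ Skeleton.P1 D < (r : ℝ) ∧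
      (r : ℝ) < Skeleton.bigP D / Skeleton.bigT D ^ 2 ∧
      (1, 1, r) ∉ Section7cStatements.tripleSet D := by
  have hP1one : 1 < Skeleton.P1 D := one_lt_P1 D hD
  have hP1pos : 0 < Skeleton.P1 D := lt_trans one_pos hP1one
  have hfl : (⌊Skeleton.P1 D⌋₊ : ℝ) ≤ Skeleton.P1 D := Nat.floor_le hP1pos.le
  have hlt : Skeleton.P1 D < ((⌊Skeleton.P1 D⌋₊ + 1 : ℕ) : ℝ) := by
    push_cast
    exact Nat.lt_floor_add_one (Skeleton.P1 D)
  refine ⟨⌊Skeleton.P1 D⌋₊ + 1, ?_, hlt, ?_, ?_⟩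
  · have h1 : 1 ≤ ⌊Skeleton.P1 D⌋₊ := Nat.le_floor (by exact_mod_cast hP1one.le)
    omega
  · have h2P1 := seven13_two_P1_le_support_bound D hD
    push_cast
    linarith
  · intro hmem
    have h := (Finset.mem_filter.mp hmem).2
    simp only [one_mul] at h
    exact absurd h (not_lt.mpr hlt.le)

/-- The dropped triple, with the log-hypothesis discharged: any `D ≥ 8` qualifies
(`log 8 = 3 log 2 > 2`). [cite: Zhang2022LandauSiegel, §7 (7.13)] -/
theorem seven13_dropped_triple_of_eight_le (D : ℕ) (hD : 8 ≤ D) :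
    ∃ r : ℕ, 1 < r ∧ Skeleton.P1 D < (r : ℝ) ∧
      (r : ℝ) < Skeleton.bigP D / Skeleton.bigT D ^ 2 ∧
      (1, 1, r) ∉ Section7cStatements.tripleSet D := by
  refine seven13_dropped_triple D ?_
  have h8 : (8 : ℝ) ≤ (D : ℝ) := by exact_mod_cast hD
  have hlog : Real.log 8 ≤ Real.log D := Real.log_le_log (by norm_num) h8
  have h38 : Real.log 8 = 3 * Real.log 2 := by
    rw [show (8 : ℝ) = 2 ^ 3 by norm_num, Real.log_pow]
    push_cast
    ring
  nlinarith [Real.log_two_gt_d9]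

/-! ## G-adj2-3: the (7.19) printed contour vs classical zero-free regions -/

/-- **THE UNCOVERED SUB-SEGMENT of G-adj2-3**, universal in the constant (`Z22:(7.19)`,
[Z22 p.40, tex L2104–2127]): for every constant `c > 0` and every height
`t ≥ exp(c𝓛) = D^c`, the point `(1 − 𝓛⁻¹) + it` of the printed contour segment
(`σ = 1 − 𝓛⁻¹`, `|t| ≤ D`; `Section7dStatements.vert747`) does NOT satisfy the classical
zero-free-region membership `σ > 1 − c/log t`. So a classical region with constant `c < 1`
justifies `1/ζ` on the printed segment only below height `D^c` — never up to the printed `D`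
(`seven19_exit_range_nonempty`). Insufficiency of the cited input class as printed; no assertion
that `ζ` has zeros there. [cite: Zhang2022LandauSiegel, §7 p.40, tex L2104–2127] -/
theorem seven19_contour_not_in_zfr (c : ℝ) (hc0 : 0 < c) (D : ℕ) (hD : 2 ≤ D)
    {t : ℝ} (ht : Real.exp (c * Skeleton.ell D) ≤ t) :
    ¬ (1 - c / Real.log t < 1 - (Skeleton.ell D)⁻¹) := by
  have hℓpos : 0 < Skeleton.ell D := by
    rw [Skeleton.ell]
    exact Real.log_pos (by exact_mod_cast hD)
  have hlogt : c * Skeleton.ell D ≤ Real.log t := by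
    have h := Real.log_le_log (Real.exp_pos _) ht
    rwa [Real.log_exp] at h
  have hcl : 0 < c * Skeleton.ell D := mul_pos hc0 hℓpos
  have h1 : 1 / Real.log t ≤ 1 / (c * Skeleton.ell D) := one_div_le_one_div_of_le hcl hlogt
  have h2 : c / Real.log t ≤ c / (c * Skeleton.ell D) := by
    rw [div_eq_mul_one_div, div_eq_mul_one_div c (c * Skeleton.ell D)]
    exact mul_le_mul_of_nonneg_left h1 hc0.le
  have h3 : c / (c * Skeleton.ell D) = (Skeleton.ell D)⁻¹ := by
    rw [div_mul_eq_div_div, div_self hc0.ne', one_div]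
  rw [not_lt]
  have h4 : c / Real.log t ≤ (Skeleton.ell D)⁻¹ := h3 ▸ h2
  linarith

/-- The uncovered height range `[D^c, D]` of `seven19_contour_not_in_zfr` is nonempty for every
`c < 1`: `exp(c𝓛) < D`. [cite: Zhang2022LandauSiegel, §7 p.40, tex L2108–2112] -/
theorem seven19_exit_range_nonempty (c : ℝ) (hc1 : c < 1) (D : ℕ) (hD : 2 ≤ D) :
    Real.exp (c * Skeleton.ell D) < D := by
  have hℓpos : 0 < Skeleton.ell D := by
    rw [Skeleton.ell]
    exact Real.log_pos (by exact_mod_cast hD)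
  have h : c * Skeleton.ell D < Skeleton.ell D := by nlinarith
  calc Real.exp (c * Skeleton.ell D) < Real.exp (Skeleton.ell D) := Real.exp_lt_exp.mpr h
    _ = D := by
        rw [Skeleton.ell, Real.exp_log (by exact_mod_cast (by omega : 0 < D))]

/-- `seven19_contour_not_in_zfr` at the explicit certified constant `c = 1/5.573412` of the
tree's classical zero-free region
(`Literature.NumberTheory.LFunctions.zero_free_region_mossinghoff_trudgian_2015_of_mossinghoff_trudgian_yang`,
MTY 2024 Thm 1.3 / MT 2015): on heights `exp(𝓛/5.573412) = D^{1/5.573412} ≤ t`, the printed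
(7.19) contour point `(1 − 𝓛⁻¹) + it` is not in the certified region
`σ > 1 − 1/(5.573412·log t)`. [cite: Zhang2022LandauSiegel, §7 p.40, tex L2104–2127;
MossinghoffTrudgianYangRNT2024, Theorem 1.3] -/
theorem seven19_contour_exits_certified_zfr (D : ℕ) (hD : 2 ≤ D) {t : ℝ}
    (ht : Real.exp (Skeleton.ell D / 5.573412) ≤ t) :
    ¬ (1 - 1 / (5.573412 * Real.log t) < 1 - (Skeleton.ell D)⁻¹) := by
  have h2 : (1 : ℝ) / (5.573412 * Real.log t) = 1 / 5.573412 / Real.log t :=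
    (div_div 1 5.573412 (Real.log t)).symm
  rw [h2]
  refine seven19_contour_not_in_zfr (1 / 5.573412) (by norm_num) D hD ?_
  rwa [show 1 / 5.573412 * Skeleton.ell D = Skeleton.ell D / 5.573412 by ring]

end Literature.NumberTheory.LFunctions.Zhang2022.AdjTeamR
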